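import Literature.Computability.Complexity.HardcoreInapproximabilityForestGlue
import Literature.Computability.Complexity.HardcoreInapproximabilityTreesConc
import HarnessLib

/-!
# Sly's gadget theorem from Theorem 3.10 alone

Allan Sly, *Computational transition at the uniqueness threshold*, FOCS 2010 (arXiv:1005.5584).

`slyGadgetReduction_of_inputs` (in `HardcoreInapproximabilityForestGlue`) derives Sly's Lemma 2.2
hypothesis `slyGadgetReduction` from two inputs: the reconstruction tail of Lemma 4.2 and the pointwise
lower tail of Theorem 3.10. Here the first input is discharged by `sly_lemma42`
(`HardcoreInapproximabilityTreesConc`), leaving `slyGadgetReduction` conditional on Theorem 3.10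
only (`slyGadgetReduction_of_thm310`). [cite: Sly2010, Lemma 4.2, Theorem 3.10, Theorem 2.1]
-/

namespace Literature.Computability.Complexity

open Finset Literature.Probability.LatticeModels

/-- A point of the two-cycle is fixed by the even iterates of `φ`. [folklore] -/
theorem hcPhi_iterate_even_of_twoCycle {q : ℕ} {lam qp qm x : ℝ} (hp : qp = hcPhi q lam qm)
    (hm : qm = hcPhi q lam qp) (hx : x = qp ∨ x = qm) {ℓ : ℕ} (hℓ : Even ℓ) :
    (hcPhi q lam)^[ℓ] x = x := by
  obtain ⟨k, rfl⟩ := hℓ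
  rw [← two_mul, Function.iterate_mul]
  apply Function.iterate_fixed
  show hcPhi q lam (hcPhi q lam x) = x
  rcases hx with rfl | rfl
  · rw [← hm, ← hp]
  · rw [← hp, ← hm]

/-- `G_L(0) + G_L(1) = Σ_A w^{|A|} Z_L(A)`. [folklore] -/
theorem hcGen_false_add_true {q : ℕ} (lam w : ℝ) (L : ℕ) :
    hcGen q lam w L false + hcGen q lam w L true = ∑ A : Fin (q ^ L) → Bool, w ^ hcLeafCount A * hcTreeZtot q lam L A := by
  unfold hcGen hcTreeZtot
  rw [← Finset.sum_add_distrib]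
  refine Finset.sum_congr rfl fun A _ => ?_
  ring

/-- **The Lemma 4.2 input of `slyGadgetReduction_of_inputs`, discharged by `sly_lemma42`.**
[cite: Sly2010, Lemma 4.2] -/
theorem sly_H42 (q : ℕ) (hq2 : 2 ≤ q) (lam : ℝ) (hlam : hardCoreThreshold (q + 1) < lam) :
    ∀ (qp qm w : ℝ), 0 < qm → qm < qp → qp < 1 →
      qp = lam * (1 - qm) ^ q / (1 + lam * (1 - qm) ^ q) →
      qm = lam * (1 - qp) ^ q / (1 + lam * (1 - qp) ^ q) →
      0 ≤ w → (w / (1 + w) = qp ∨ w / (1 + w) = qm) →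
      ∃ ζ₁ ζ₂ : ℝ, 0 < ζ₁ ∧ 0 < ζ₂ ∧ ∃ ℓ₀ : ℕ, ∀ ℓ : ℕ, ℓ₀ ≤ ℓ → Even ℓ →
        (∑ A : Fin (q ^ ℓ) → Bool,
            if Real.exp (-(ζ₁ * ℓ)) ≤ |hcTreeX q lam ℓ A - w / (1 + w)| then
              w ^ hcLeafCount A * hcTreeZtot q lam ℓ A else 0) ≤
          Real.exp (-Real.exp (ζ₂ * ℓ)) * ∑ A : Fin (q ^ ℓ) → Bool, w ^ hcLeafCount A * hcTreeZtot q lam ℓ A := by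
  intro qp qm w hqm hlt hqp1 hp hm hw hwc
  have hd : 3 ≤ q + 1 := by omega
  have hlam0 : 0 < lam := (hardCoreThreshold_pos hd).trans hlam
  have hp' : qp = hcPhi q lam qm := by rw [hcPhi_eq]; exact hp
  have hm' : qm = hcPhi q lam qp := by rw [hcPhi_eq]; exact hm
  obtain ⟨ζ₁, ζ₂, h1, h2, ℓ₀, hℓ⟩ := sly_lemma42 (d := q + 1) hd hlam0 hqm hlt hqp1
    (by simpa only [Nat.add_sub_cancel] using hp') (by simpa only [Nat.add_sub_cancel] using hm') hw hwc
  simp only [Nat.add_sub_cancel] at hℓ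
  refine ⟨ζ₁, ζ₂, h1, h2, ℓ₀, fun ℓ hℓ0 heven => ?_⟩
  have h := hℓ ℓ hℓ0
  rw [hcPhi_iterate_even_of_twoCycle hp' hm' hwc heven, hcGen_false_add_true,
    div_le_iff₀ (by rw [← hcGen_false_add_true]; exact hcGen_tot_pos hlam0.le hw ℓ)] at h
  exact h

open scoped Classical in
/-- **`slyGadgetReduction` from Sly's Theorem 3.10 alone** (pointwise lower tail of the phase partition
functions of the random bipartite core, counting form, on the `(d, λ)` ranges where Condition 1.2 is in
print: `d = 3` [GGŠVY Lemma 5] or `λ ≤ λ_c(𝕋_{d-1})` [GŠV16 Lemma 4, GGŠVY Cor. 6] — the covering used by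
`slyGadgetReduction_of_gadgetsAt`): everything else in Sly's proof of Theorem 2.1 —
the first moment (Lemma 3.3), the gadget and its cut decomposition, the tree recursion and
reconstruction bound (Lemmas 4.2–4.3), the reweighting and the union bounds — is proved in this
development. [cite: Sly2010, Theorem 2.1, Theorem 3.10, Lemma 2.2] -/
theorem slyGadgetReduction_of_thm310
    (HT6 : ∀ (q : ℕ), 2 ≤ q → ∀ (lam : ℝ), hardCoreThreshold (q + 1) < lam →
      (q + 1 = 3 ∨ lam ≤ hardCoreThreshold q) →
      ∃ γ₆ : ℝ, 0 < γ₆ ∧ ∃ n₆ : ℕ, ∀ n : ℕ, n₆ ≤ n → ∀ m' : ℕ, (m' : ℝ) ≤ (n : ℝ) ^ γ₆ →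
      ∀ (s : Bool) (Ep Em : Finset (Fin m')),
        16 * ((univ.filter fun ω : (Fin q → Equiv.Perm (Fin (n + m'))) × Equiv.Perm (Fin n) =>
          (Fintype.card ((Fin q → Equiv.Perm (Fin (n + m'))) × Equiv.Perm (Fin n)) : ℝ) * slyCoreZ ω.1 ω.2 lam s Ep Em <
            (∑ ω' : (Fin q → Equiv.Perm (Fin (n + m'))) × Equiv.Perm (Fin n), slyCoreZ ω'.1 ω'.2 lam s Ep Em) /
              Real.sqrt n).card : ℝ) ≤
          Fintype.card ((Fin q → Equiv.Perm (Fin (n + m'))) × Equiv.Perm (Fin n))) :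
    slyGadgetReduction := by
  refine slyGadgetReduction_of_gadgetsAt fun d hd lam hlam hcov => ?_
  obtain ⟨q, rfl⟩ : ∃ q, d = q + 1 := ⟨d - 1, by omega⟩
  have hq2 : 2 ≤ q := by omega
  simp only [Nat.add_sub_cancel] at hcov ⊢
  exact slyGadgetsAt_of_inputs hq2 hlam (sly_H42 q hq2 lam hlam) (HT6 q hq2 lam hlam hcov)

end Literature.Computability.Complexity
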